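import Mathlib.LinearAlgebra.BilinearMap
import Mathlib.Algebra.Module.LinearMap.Basic
import Mathlib.Tactic.Ring
import Mathlib.Tactic.LinearCombination
import HarnessLib

/-!
# Route ByReductionTypeAtTwo, crux `RankOneAtTwoBigImageOddLocal` (stmt-BirchSwinnertonDyer-23715), LINE v8.6 `one_door_analytic`:
# the linear-algebra identity behind INERT-PRIME ISOTROPY AT 2 (lead prover seat `bsd-line-fkl-p1` g9, 2026-08-28)

Support lemma for the Euler-system half `RankOneAtTwoOneDoor.DoorIndexLawUpperCAtTwo` (AN-28c-U) of the line of record; it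
records, in kernel-checked form, the one identity on which the lead's obstruction analysis (crux report
`Cruxes/RankOneAtTwoBigImageOddLocal/OneDoorLeadReportG9.md`) rests.  Nothing Galois-cohomological is formalised here and
nothing about the crux is asserted; BSD is not proved by any of this.

The analysis (informal, for the planners; see the report for the full argument and its sources).  Let `M = 2^k`, `K` the door
field, `ℓ ∤ 2N` a Kolyvagin prime (inert in `K`, `M ∣ ℓ + 1`, `M ∣ a_ℓ`), `λ ∣ ℓ`, `F = Frob_ℓ` acting on `E[M]` (so
`F² = 1`, `det F = ℓ ≡ -1 (mod M)`).  Local Tate duality at `λ` identifies the finite part `E(K_λ)/M` and the singular part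
`H¹(K_λ, E)[M]` with `E[M]` and the pairing with the Weil pairing `e_M`, which is bilinear, alternating and GALOIS-EQUIVARIANT:
`e_M(Fx, Fy) = e_M(x, y)^{det F}`.  (a) A Selmer class FROM `ℚ` (every `Gal(K/ℚ)`-invariant class of `Sel_M(E/K)` is one when
`E(K)[2] = 0`, by inflation–restriction) localises at `λ` to `(1 + F)x` (restriction from `Frob_ℓ` to `Frob_λ = Frob_ℓ²`).
(b) On the analytic-rank-ONE slice the Heegner point `y_K` lies in `E(ℚ) +` odd torsion, so the singular value of Kolyvagin's
first-layer class `c_M(ℓ)` — the reduction of `((ℓ+1)F − a_ℓ)/M · y_K` (Gross 1991 Props. 3.7, 6.2; the computation is integral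
and sign-free, hence valid at `2`) — is FIXED by `F`.  (c) The identity below with `d = det F = -1`: `e_M((1+F)x, q) = 1` for
`Fq = q`.  Hence the reciprocity relation `Σ_v ⟨s_v, c_M(ℓ)_v⟩_v = 0` is VACUOUS on the `Gal(K/ℚ)`-invariant part of
`Sel_M(E/K)`, which contains the restrictions of `Sel_M(E/ℚ)` and `Sel_M(E^{(d_K)}/ℚ)` (`E[M] ≅ E^{(d_K)}[M]` only for `M = 2`;
for `M = 2^k` the invariant part is `res H¹(ℚ, E[M]) ∩ Sel`).  The second-layer classes `c_M(ℓℓ')` have singular value in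
`ker(F' + 1)` (the sign `ε_ℓ = -ε`), and the second identity below shows they pair into `2 · (ℤ/M)`: at odd `M` nothing is lost
(this is Gross's eigenspace argument), at `M = 2^k` one bit per auxiliary prime is lost.  Reading: the sharp upper half at `2`
is not reachable by refining Kolyvagin's inert-prime induction (the printed bound at `2` carries an error term: Kolyvagin 1990
Cor. 11–13 as reported by Matar–Nekovář 2019 §0.2–0.3); Bertolini–Darmon admissible primes need `p ∤ ℓ² − 1`, impossible at
`p = 2`; the Iwasawa main conjecture is not known at `2` (Kriz–Li 2019 p. 16: «the only known way to prove BSD(2) over `ℚ` is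
to compute the 2-part of both sides explicitly»; their Cor. 4.2: under (★), BSD(2) for `E/K` ⟺ all `c_ℓ(E)` odd and
`Ш(E/K)[2] = 0`).  A line for the U child must bring a mechanism outside these three.

References (locators): Gross, *Kolyvagin's work on modular elliptic curves* (1991) Props. 3.7, 5.4, 6.1, 6.2, §§8–9;
Kolyvagin, ICM 1990 address, Thm. 5 and Example 2; Kriz–Li, Forum Math. Sigma 7 (2019) e15, Cor. 4.2 and p. 16;
Matar–Nekovář, JTNB 31 (2019) §0.2–0.3; Bertolini–Darmon, Ann. of Math. 162 (2005) §2.2 (admissible primes).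
-/

set_option autoImplicit false
set_option linter.dupNamespace false

namespace Summit.BirchSwinnertonDyer.BirchSwinnertonDyer.Theorems.RankOneAtTwoOneDoor

variable {R : Type*} [CommRing R] {V : Type*} [AddCommGroup V] [Module R V]

/-- **Inert-prime isotropy, the general identity.**  For a bilinear pairing `B` that is `F`-equivariant up to the scalar
`d` (`B (F x) (F y) = d * B x y`, the Weil pairing with `d = det F`) and a vector `q` FIXED by `F`, the "restricted-from-`ℚ`"
vector `x + F x` pairs with `q` to `(1 + d) * B x q`.
[cite: GrossLMS1991, Props. 3.7 and 6.2 (the singular value of c(ℓ) is a Frobenius-fixed multiple of the reduction of y_K)] -/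
theorem pairing_add_map_self_of_fixed (B : V →ₗ[R] V →ₗ[R] R) (F : V →ₗ[R] V) (d : R)
    (hB : ∀ x y : V, B (F x) (F y) = d * B x y) (x q : V) (hq : F q = q) :
    B (x + F x) q = (1 + d) * B x q := by
  have h : B (F x) q = d * B x q := by simpa only [hq] using hB x q
  rw [map_add, LinearMap.add_apply, h]
  ring

/-- **Inert-prime isotropy at a Kolyvagin prime** (`d = det Frob_ℓ = ℓ ≡ -1`): the pairing of `x + F x` with an `F`-fixed
vector VANISHES identically.  On the analytic-rank-one slice this is the statement that Kolyvagin's first-layer class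
`c_M(ℓ)` imposes no condition at `λ ∣ ℓ` on the `Gal(K/ℚ)`-invariant part of `Sel_M(E/K)` (module docstring).
[cite: GrossLMS1991, §§8–9 (the first layer controls only the (−ε)-eigenspace)] -/
theorem pairing_add_map_self_eq_zero_of_fixed (B : V →ₗ[R] V →ₗ[R] R) (F : V →ₗ[R] V)
    (hB : ∀ x y : V, B (F x) (F y) = (-1 : R) * B x y) (x q : V) (hq : F q = q) :
    B (x + F x) q = 0 := by
  rw [pairing_add_map_self_of_fixed B F (-1) hB x q hq]
  ring

/-- **The second layer pairs into `2 · R`.**  For `q` ANTI-fixed by `F` (`F q = -q`: the singular value of the second-layer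
class `c_M(ℓℓ')`, whose sign is `ε_ℓ = -ε`) and `d = -1`, the pairing of `x + F x` with `q` is `2 * B x q`: invertible
information when `2` is a unit of `R` (odd `M`, Gross's eigenspace argument), ONE BIT LOST when `R = ℤ/2^k`.
[cite: GrossLMS1991, Prop. 5.4 and §9 (sign ε_n and the second-layer classes)] -/
theorem pairing_add_map_self_of_antifixed (B : V →ₗ[R] V →ₗ[R] R) (F : V →ₗ[R] V)
    (hB : ∀ x y : V, B (F x) (F y) = (-1 : R) * B x y) (x q : V) (hq : F q = -q) :
    B (x + F x) q = 2 * B x q := by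
  have h : B (F x) q = B x q := by
    have h1 : B (F x) (F q) = (-1 : R) * B x q := hB x q
    rw [hq, map_neg] at h1
    linear_combination (-1 : R) * h1
  rw [map_add, LinearMap.add_apply, h]
  ring

/-- **No loss away from `2`.**  If `2` is a unit of the coefficient ring (every odd `M`), the second-layer pairing recovers
`B x q` exactly: `B x q = ⅟2 * B (x + F x) q`. [cite: GrossLMS1991, §9 (p odd)] -/
theorem pairing_eq_invOf_two_mul_of_antifixed [Invertible (2 : R)] (B : V →ₗ[R] V →ₗ[R] R) (F : V →ₗ[R] V)
    (hB : ∀ x y : V, B (F x) (F y) = (-1 : R) * B x y) (x q : V) (hq : F q = -q) :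
    B x q = ⅟(2 : R) * B (x + F x) q := by
  rw [pairing_add_map_self_of_antifixed B F hB x q hq, ← mul_assoc, invOf_mul_self, one_mul]

end Summit.BirchSwinnertonDyer.BirchSwinnertonDyer.Theorems.RankOneAtTwoOneDoor
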